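import Summits.KontsevichZagierPeriods.Zeta5Search.Denom.TwoTaleP15CoincidenceFlat
import Literature.NumberTheory.DiophantineApproximation.LcmUptoExpBound
import Literature.NumberTheory.Transcendental.ZudilinLemma19

/-!
# P15: the ♭ integrality input from Prop. 3 (print) and a top-window valuation statement

HONEST FRAMING: systematic search; no irrationality claim unless certified.  NOTHING about `ζ(2)`
is certified here beyond the tree's facts: the two inputs `Prop3T` (a PRINTED theorem not yet
formalised in this tree) and `TopWindowT` (OPEN) are `@[conjecture]` defs, and every measure
statement below is an implication from them and from `DecayT` (tree def, open).

Cell pub-zeta5, fam-denom g7 (design `families/denom/P15KERNEL.md` §10.7; exact-arithmetic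
evidence `code/denom/p15/u3/RESULTS.md`).  The tree's (bmiss)-free P15 reduction
(`Denom.TwoTaleP15CoincidenceFlat.pCoincidence_eventually_flat`) needs, on the arithmetic side,
`IntegralTFlat`: a positive integer sequence `E_n = e^{o(n)}` with `E_n D₁₆ₙD₁₅ₙ p̂_n ∈ ℤ`
eventually.  This file PROVES the decomposition

  `Prop3T ∧ TopWindowT → IntegralTFlat`      (`integralTFlat_of_prop3T_topWindowT`)

with the explicit choice `E_n = lcm(1,…,⌊√(26n)⌋)⁶` (`fudge`), where

* `Prop3T` — `D₂₂ₙ D₂₆ₙ p̂_n ∈ ℤ` for `n ≥ 1`: this IS [Zudilin2014ZetaTwo, Prop. 3] at the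
  Remark-5 partner of P15 (`ĉ₁ = max{17n, 5n, 13n, 11n, 22n} = 22n`, `ĉ₂ = 2·(26n+2) − (26n+2) − 2
  = 26n`), a theorem IN PRINT; it is an input here only because the tree formalises the
  single-digit-prime valuation API of that proof (`TwoTaleP15.padicNorm_formPT_le`, `26n < p²`)
  and not the multi-digit primes `p ≤ √(26n)`;
* `TopWindowT` — for all large `n` and every prime `15n < p ≤ 26n + 1`:
  `|p̂_n|_p ≤ p^{[p ≤ 16n]}`, i.e. `ord_p p̂_n ≥ −1` on `(15n, 16n]` and `p̂_n` is `p`-integral on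
  `(16n, 26n+1]`.  OPEN, NOT in print; implied by (bmiss)@P15 (then `p̂_n = −p_n` and
  `D₁₆ₙD₁₅ₙ p_n ∈ ℤ`); observed exactly for `n ≤ 12` and explained (design grade) by a "slice law"
  on the values `R̂(p/2 − k)` — see `P15KERNEL.md` §10.7.  This is where the new arithmetic sits.

Mechanism (PROVED, elementary): prime by prime, `ord_p(D₂₂ₙD₂₆ₙ) ≤ ord_p(E_n D₁₆ₙD₁₅ₙ T_n)`
where `T_n = ∏_{15n<p≤26n+1} p^{t(p)}`, `t = 1, 2, 1, 0` on `(15n,16n]`, `(16n,22n]`, `(22n,26n]`,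
`{26n+1}` (`bigD_dvd`): primes `p² ≤ 26n` are covered by `E_n` (`6⌊log_p √(26n)⌋ ≥ 2⌊log_p 26n⌋`),
primes `√(26n) < p ≤ 15n` by `D₁₆ₙD₁₅ₙ` itself, the top window by `T_n`; and `T_n ∣ D₂₂ₙD₂₆ₙ p̂_n`
is exactly `TopWindowT` (`topProd_dvd`).  Growth: `E_n ≤ e^{24√(26n)} ≤ e^{εn}` eventually, from
the tree's Chebyshev bound `LcmUptoExpBound.eventually_lcmUpto_le_exp`.  Exact integer
checks of both inputs for `n ≤ 6` (and of `TopWindowT` for `n ≤ 12`): `code/denom/p15/u3/`.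

References: W. Zudilin, arXiv:1310.1526, Ann. Math. Québec 38 (2014) 101–117 [Zudilin2014ZetaTwo].
-/

noncomputable section

open Filter Topology Finset
open Literature.NumberTheory.Irrationality.Zudilin2014
open Literature.NumberTheory.Transcendental (zetaValue OddZeta.dvd_lcmUpto)
open Literature.NumberTheory.DiophantineApproximation (eventually_lcmUpto_le_exp)
open Literature.NumberTheory.Transcendental.Zudilin2004 (padicValNat_lcmUpto)
open Summit.KontsevichZagierPeriods.Zeta5Search.TwoTaleP15
open Summit.KontsevichZagierPeriods.Zeta5Search.Denom.TwoTaleP15Saving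
open Summit.KontsevichZagierPeriods.Zeta5Search.Denom.TwoTaleP15Forms (lcmNormaliser
  lcmNormaliser_pos)
open Summit.KontsevichZagierPeriods.Zeta5Search.Denom.TwoTaleP15Coincidence
open Summit.KontsevichZagierPeriods.Zeta5Search.Denom.TwoTaleP15CoincidenceFlat

namespace Summit.KontsevichZagierPeriods.Zeta5Search.Denom.TwoTaleP15TopWindow

/-! ### The two inputs (NOT certified in this tree) -/

/-- **INPUT — [Zudilin2014ZetaTwo, Prop. 3] at the partner of P15** (PRINTED theorem, NOT yet
formalised here): `D₂₂ₙ D₂₆ₙ p̂_n ∈ ℤ` for `n ≥ 1`. -/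
@[conjecture] def Prop3T : Prop :=
  ∀ n : ℕ, 1 ≤ n → ∃ z : ℤ,
    ((Nat.lcmUpto (22 * n) * Nat.lcmUpto (26 * n) : ℕ) : ℚ) * formPT (aT n) (bT n) = z

/-- **INPUT U3a — the top window** (OPEN, NOT in print): for all large `n` and every prime
`15n < p ≤ 26n + 1`, `|p̂_n|_p ≤ p^{[p ≤ 16n]}`. -/
@[conjecture] def TopWindowT : Prop :=
  ∀ᶠ n : ℕ in atTop, ∀ p : ℕ, p.Prime → 15 * n < p → p ≤ 26 * n + 1 →
    padicNorm p (formPT (aT n) (bT n)) ≤ (p : ℚ) ^ (if p ≤ 16 * n then (1 : ℤ) else 0)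

/-! ### The fudge factor and the top-window product -/

/-- `E_n = lcm(1, …, ⌊√(26n)⌋)⁶` — absorbs the multi-digit primes `p² ≤ 26n`. -/
def fudge (n : ℕ) : ℕ := Nat.lcmUpto (Nat.sqrt (26 * n)) ^ 6

/-- The exponent `t(p)` of a top-window prime: `1` on `(15n,16n]`, `2` on `(16n,22n]`, `1` on
`(22n,26n]`, `0` at `26n+1` (`= ord_p(D₂₂ₙD₂₆ₙ) − ord_p(D₁₆ₙD₁₅ₙ)` there, given `TopWindowT`). -/
def topExp (n p : ℕ) : ℕ :=
  if p ≤ 16 * n then 1 else if p ≤ 22 * n then 2 else if p ≤ 26 * n then 1 else 0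

/-- The top-window primes `15n < p ≤ 26n + 1`. -/
def topPrimes (n : ℕ) : Finset ℕ := (Finset.Ioc (15 * n) (26 * n + 1)).filter Nat.Prime

/-- `T_n = ∏_{15n < p ≤ 26n+1} p^{t(p)}`. -/
def topProd (n : ℕ) : ℕ := ∏ p ∈ topPrimes n, p ^ topExp n p

/-- `0 < E_n`. -/
theorem fudge_pos (n : ℕ) : 0 < fudge n := pow_pos (Nat.lcmUpto_pos _) 6

/-- `T_n ≠ 0`. -/
theorem topProd_ne_zero (n : ℕ) : topProd n ≠ 0 :=
  Finset.prod_ne_zero_iff.2 fun _ hp => pow_ne_zero _ (Finset.mem_filter.1 hp).2.ne_zero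

/-- Membership in `topPrimes`. -/
theorem mem_topPrimes {n p : ℕ} : p ∈ topPrimes n ↔ (15 * n < p ∧ p ≤ 26 * n + 1) ∧ p.Prime := by
  simp [topPrimes, Finset.mem_filter, Finset.mem_Ioc]

/-! ### Prime by prime: `D₂₂ₙD₂₆ₙ ∣ E_n · D₁₆ₙD₁₅ₙ · T_n` -/

/-- The multi-digit primes: for `p² ≤ 26n`, `⌊log_p 22n⌋ + ⌊log_p 26n⌋ ≤ 6⌊log_p ⌊√(26n)⌋⌋`. -/
theorem log_le_of_sq_le {n p : ℕ} (hp : p.Prime) (hn : 1 ≤ n) (h : p * p ≤ 26 * n) :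
    Nat.log p (22 * n) + Nat.log p (26 * n) ≤ 6 * Nat.log p (Nat.sqrt (26 * n)) := by
  have hp1 : 1 < p := hp.one_lt
  have h26 : 26 * n ≠ 0 := by omega
  have hL2 : 2 ≤ Nat.log p (26 * n) := (Nat.le_log_iff_pow_le hp1 h26).2 (by rw [pow_two]; exact h)
  have h22 : Nat.log p (22 * n) ≤ Nat.log p (26 * n) := Nat.log_mono_right (by omega)
  have hs : p ≤ Nat.sqrt (26 * n) := Nat.le_sqrt.2 h
  have hs0 : Nat.sqrt (26 * n) ≠ 0 := by omega
  have hhalf : Nat.log p (26 * n) / 2 ≤ Nat.log p (Nat.sqrt (26 * n)) := by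
    refine (Nat.le_log_iff_pow_le hp1 hs0).2 (Nat.le_sqrt.2 ?_)
    rw [← pow_add]
    calc p ^ (Nat.log p (26 * n) / 2 + Nat.log p (26 * n) / 2) ≤ p ^ Nat.log p (26 * n) :=
          Nat.pow_le_pow_right hp.pos (by omega)
      _ ≤ 26 * n := Nat.pow_log_le_self p h26
  omega

/-- **`D₂₂ₙ D₂₆ₙ ∣ E_n · D₁₆ₙD₁₅ₙ · T_n`** (`n ≥ 1`), prime by prime. -/
theorem bigD_dvd {n : ℕ} (hn : 1 ≤ n) :
    Nat.lcmUpto (22 * n) * Nat.lcmUpto (26 * n) ∣ fudge n * lcmNormaliser n * topProd n := by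
  rw [Nat.dvd_iff_prime_pow_dvd_dvd]
  intro p k hp hk
  haveI : Fact p.Prime := ⟨hp⟩
  have hp1 : 1 < p := hp.one_lt
  have hD0 : Nat.lcmUpto (22 * n) * Nat.lcmUpto (26 * n) ≠ 0 :=
    Nat.mul_ne_zero (Nat.lcmUpto_pos _).ne' (Nat.lcmUpto_pos _).ne'
  have hk' : k ≤ Nat.log p (22 * n) + Nat.log p (26 * n) := by
    have := (padicValNat_dvd_iff_le hD0).1 hk
    rwa [padicValNat.mul (Nat.lcmUpto_pos _).ne' (Nat.lcmUpto_pos _).ne', padicValNat_lcmUpto,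
      padicValNat_lcmUpto] at this
  have hE0 : fudge n ≠ 0 := (fudge_pos n).ne'
  have hN0 : lcmNormaliser n ≠ 0 := (lcmNormaliser_pos n).ne'
  have hT0 : topProd n ≠ 0 := topProd_ne_zero n
  refine (padicValNat_dvd_iff_le (Nat.mul_ne_zero (Nat.mul_ne_zero hE0 hN0) hT0)).2 ?_
  rw [padicValNat.mul (Nat.mul_ne_zero hE0 hN0) hT0, padicValNat.mul hE0 hN0, fudge,
    padicValNat.pow, padicValNat_lcmUpto, lcmNormaliser,
    padicValNat.mul (Nat.lcmUpto_pos _).ne' (Nat.lcmUpto_pos _).ne', padicValNat_lcmUpto,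
    padicValNat_lcmUpto]
  -- the top-window exponent is available in `ord_p T_n`
  have hT : p ∈ topPrimes n → topExp n p ≤ padicValNat p (topProd n) := by
    intro hmem
    exact (padicValNat_dvd_iff_le hT0).1 (Finset.dvd_prod_of_mem (fun q => q ^ topExp n q) hmem)
  rcases le_or_gt (p * p) (26 * n) with hsq | hsq
  · -- multi-digit primes: covered by `E_n`
    have := log_le_of_sq_le hp hn hsq
    omega
  · -- single-digit primes: `⌊log_p 22n⌋, ⌊log_p 26n⌋ ≤ 1`
    have l22 : Nat.log p (22 * n) < 2 := Nat.log_lt_of_lt_pow (by omega) (by rw [pow_two]; omega)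
    have l26 : Nat.log p (26 * n) < 2 := Nat.log_lt_of_lt_pow (by omega) (by rw [pow_two]; omega)
    rcases le_or_gt p (15 * n) with h15 | h15
    · have l16 : 0 < Nat.log p (16 * n) := Nat.log_pos hp1 (by omega)
      have l15 : 0 < Nat.log p (15 * n) := Nat.log_pos hp1 h15
      omega
    rcases le_or_gt p (26 * n + 1) with h27 | h27
    · have ht := hT (mem_topPrimes.2 ⟨⟨h15, h27⟩, hp⟩)
      unfold topExp at ht
      rcases le_or_gt p (16 * n) with h16 | h16
      · have l16 : 0 < Nat.log p (16 * n) := Nat.log_pos hp1 h16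
        rw [if_pos h16] at ht
        omega
      rw [if_neg (by omega)] at ht
      rcases le_or_gt p (22 * n) with h22 | h22
      · rw [if_pos h22] at ht
        omega
      rw [if_neg (by omega)] at ht
      have z22 : Nat.log p (22 * n) = 0 := Nat.log_of_lt h22
      rcases le_or_gt p (26 * n) with h26 | h26
      · rw [if_pos h26] at ht
        omega
      have z26 : Nat.log p (26 * n) = 0 := Nat.log_of_lt h26
      omega
    · have z22 : Nat.log p (22 * n) = 0 := Nat.log_of_lt (by omega)
      have z26 : Nat.log p (26 * n) = 0 := Nat.log_of_lt (by omega)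
      omega

/-! ### The top window gives `T_n ∣ D₂₂ₙD₂₆ₙ p̂_n` -/

/-- `|D_M|_p ≤ p⁻¹` for `p ≤ M`, and `≤ 1` always. -/
theorem padicNorm_lcmUpto_le {p M : ℕ} [hp : Fact p.Prime] (h : p ≤ M) :
    padicNorm p ((Nat.lcmUpto M : ℕ) : ℚ) ≤ (p : ℚ) ^ (-(1 : ℤ)) := by
  have hdvd : ((p ^ 1 : ℕ) : ℤ) ∣ ((Nat.lcmUpto M : ℕ) : ℤ) := by
    rw [pow_one]; exact_mod_cast OddZeta.dvd_lcmUpto hp.out.one_lt.le h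
  have := (padicNorm.dvd_iff_norm_le (p := p)).1 hdvd
  simpa using this

/-- **`T_n ∣ D₂₂ₙD₂₆ₙ p̂_n`** from the top-window valuations (one prime power at a time; the prime
powers are pairwise coprime). -/
theorem topProd_dvd {n : ℕ}
    (hw : ∀ p : ℕ, p.Prime → 15 * n < p → p ≤ 26 * n + 1 →
      padicNorm p (formPT (aT n) (bT n)) ≤ (p : ℚ) ^ (if p ≤ 16 * n then (1 : ℤ) else 0))
    {z : ℤ}
    (hz : ((Nat.lcmUpto (22 * n) * Nat.lcmUpto (26 * n) : ℕ) : ℚ) * formPT (aT n) (bT n) = z) :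
    (topProd n : ℤ) ∣ z := by
  rw [topProd]
  push_cast
  refine Finset.prod_dvd_of_coprime ?_ ?_
  · intro p hp q hq hne
    have hpP := (mem_topPrimes.1 (by exact_mod_cast hp)).2
    have hqP := (mem_topPrimes.1 (by exact_mod_cast hq)).2
    have := (Nat.coprime_pow_primes (topExp n p) (topExp n q) hpP hqP hne).isCoprime
    simpa using this
  · intro p hp
    obtain ⟨⟨h15, h27⟩, hpP⟩ := mem_topPrimes.1 hp
    haveI : Fact p.Prime := ⟨hpP⟩
    have hp0 : (p : ℚ) ≠ 0 := by exact_mod_cast hpP.ne_zero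
    have hp1 : (1 : ℚ) ≤ p := by exact_mod_cast hpP.one_lt.le
    have key : padicNorm p (z : ℚ) ≤ (p : ℚ) ^ (-(topExp n p : ℤ)) := by
      rw [← hz, Nat.cast_mul, padicNorm.mul, padicNorm.mul]
      have hP := hw p hpP h15 h27
      have one22 : padicNorm p ((Nat.lcmUpto (22 * n) : ℕ) : ℚ) ≤ 1 := padicNorm.of_nat _
      have one26 : padicNorm p ((Nat.lcmUpto (26 * n) : ℕ) : ℚ) ≤ 1 := padicNorm.of_nat _
      have oneP : padicNorm p (formPT (aT n) (bT n)) ≤ (p : ℚ) ^ (1 : ℤ) := by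
        refine hP.trans (zpow_le_zpow_right₀ hp1 ?_); split_ifs <;> norm_num
      have nn := padicNorm.nonneg (p := p) (formPT (aT n) (bT n))
      have nn22 := padicNorm.nonneg (p := p) ((Nat.lcmUpto (22 * n) : ℕ) : ℚ)
      have nn26 := padicNorm.nonneg (p := p) ((Nat.lcmUpto (26 * n) : ℕ) : ℚ)
      unfold topExp
      rcases le_or_gt p (16 * n) with h16 | h16
      · rw [if_pos h16] at hP
        rw [if_pos h16]
        calc _ ≤ (p : ℚ) ^ (-(1 : ℤ)) * (p : ℚ) ^ (-(1 : ℤ)) * (p : ℚ) ^ (1 : ℤ) :=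
              mul_le_mul (mul_le_mul (padicNorm_lcmUpto_le (by omega))
                (padicNorm_lcmUpto_le (by omega)) nn26 (by positivity)) hP nn (by positivity)
          _ = (p : ℚ) ^ (-((1 : ℕ) : ℤ)) := by
              rw [← zpow_add₀ hp0, ← zpow_add₀ hp0]; norm_num
      rw [if_neg (not_le.2 h16)] at hP
      rcases le_or_gt p (22 * n) with h22 | h22
      · rw [if_neg (not_le.2 h16), if_pos h22]
        calc _ ≤ (p : ℚ) ^ (-(1 : ℤ)) * (p : ℚ) ^ (-(1 : ℤ)) * (p : ℚ) ^ (0 : ℤ) :=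
              mul_le_mul (mul_le_mul (padicNorm_lcmUpto_le h22)
                (padicNorm_lcmUpto_le (by omega)) nn26 (by positivity)) hP nn (by positivity)
          _ = (p : ℚ) ^ (-((2 : ℕ) : ℤ)) := by
              rw [← zpow_add₀ hp0, ← zpow_add₀ hp0]; norm_num
      rcases le_or_gt p (26 * n) with h26 | h26
      · rw [if_neg (not_le.2 h16), if_neg (not_le.2 h22), if_pos h26]
        calc _ ≤ 1 * (p : ℚ) ^ (-(1 : ℤ)) * (p : ℚ) ^ (0 : ℤ) :=
              mul_le_mul (mul_le_mul one22 (padicNorm_lcmUpto_le h26) nn26 zero_le_one) hP nn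
                (by positivity)
          _ = (p : ℚ) ^ (-((1 : ℕ) : ℤ)) := by norm_num
      · rw [if_neg (not_le.2 h16), if_neg (not_le.2 h22), if_neg (not_le.2 h26)]
        calc _ ≤ 1 * 1 * (p : ℚ) ^ (0 : ℤ) :=
              mul_le_mul (mul_le_mul one22 one26 nn26 zero_le_one) hP nn (by positivity)
          _ = (p : ℚ) ^ (-((0 : ℕ) : ℤ)) := by norm_num
    exact_mod_cast (padicNorm.dvd_iff_norm_le (p := p) (n := topExp n p) (z := z)).2 key

/-! ### Growth of the fudge factor -/

/-- `⌊√(26n)⌋ → ∞`. -/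
theorem tendsto_sqrt : Tendsto (fun n : ℕ => Nat.sqrt (26 * n)) atTop atTop := by
  refine tendsto_atTop_atTop.2 fun b => ⟨b * b, fun n hn => Nat.le_sqrt.2 ?_⟩
  nlinarith

/-- **`E_n ≤ e^{εn}` eventually, for every `ε > 0`** (`E_n ≤ e^{6(log 4 + 1)√(26n)}` by the
tree's Chebyshev bound). -/
theorem fudge_le_exp {ε : ℝ} (hε : 0 < ε) :
    ∀ᶠ n : ℕ in atTop, (fudge n : ℝ) ≤ Real.exp (ε * n) := by
  have h1 := tendsto_sqrt.eventually (eventually_lcmUpto_le_exp one_pos)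
  have h2 := tendsto_sqrt.eventually (eventually_ge_atTop ⌈624 / ε⌉₊)
  filter_upwards [h1, h2] with n hn hN
  have hss : ((Nat.sqrt (26 * n) : ℕ) : ℝ) * (Nat.sqrt (26 * n) : ℕ) ≤ 26 * n := by
    exact_mod_cast Nat.sqrt_le (26 * n)
  have hlog4 : Real.log 4 + 1 ≤ 4 := by
    have := Real.log_le_sub_one_of_pos (by norm_num : (0 : ℝ) < 4); linarith
  have hs0 : (0 : ℝ) ≤ (Nat.sqrt (26 * n) : ℕ) := Nat.cast_nonneg _
  have hNs : 624 / ε ≤ (Nat.sqrt (26 * n) : ℕ) := (Nat.le_ceil _).trans (by exact_mod_cast hN)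
  have h624 : 624 ≤ ε * (Nat.sqrt (26 * n) : ℕ) := by
    have := (div_le_iff₀ hε).1 hNs; linarith
  have hkey : 6 * ((Real.log 4 + 1) * (Nat.sqrt (26 * n) : ℕ)) ≤ ε * n := by nlinarith
  rw [fudge, Nat.cast_pow]
  calc ((Nat.lcmUpto (Nat.sqrt (26 * n)) : ℕ) : ℝ) ^ 6
      ≤ Real.exp ((Real.log 4 + 1) * (Nat.sqrt (26 * n) : ℕ)) ^ 6 :=
        pow_le_pow_left₀ (Nat.cast_nonneg _) hn 6
    _ = Real.exp (6 * ((Real.log 4 + 1) * (Nat.sqrt (26 * n) : ℕ))) := by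
        rw [← Real.exp_nat_mul]; norm_num
    _ ≤ Real.exp (ε * n) := Real.exp_le_exp.2 hkey

/-! ### The decomposition -/

/-- **`Prop3T → TopWindowT → IntegralTFlat`** (PROVED; the two inputs are NOT certified), with
`E_n = lcm(1,…,⌊√(26n)⌋)⁶`: `E_n D₁₆ₙD₁₅ₙ p̂_n = M_n w_n` where
`E_n D₁₆ₙD₁₅ₙ T_n = D₂₂ₙD₂₆ₙ M_n` (`bigD_dvd`) and `D₂₂ₙD₂₆ₙ p̂_n = T_n w_n` (`topProd_dvd`). -/
theorem integralTFlat_of_prop3T_topWindowT (h3 : Prop3T) (hW : TopWindowT) : IntegralTFlat := by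
  have hW' : ∀ᶠ n : ℕ in atTop, ∀ p : ℕ, p.Prime → 15 * n < p → p ≤ 26 * n + 1 →
      padicNorm p (formPT (aT n) (bT n)) ≤ (p : ℚ) ^ (if p ≤ 16 * n then (1 : ℤ) else 0) := hW
  refine ⟨fudge, fudge_pos, fun ε hε => fudge_le_exp hε, ?_⟩
  filter_upwards [hW', eventually_ge_atTop 1] with n hw hn
  obtain ⟨z, hz⟩ := h3 n hn
  obtain ⟨M, hM⟩ := bigD_dvd hn
  obtain ⟨w, hw'⟩ := topProd_dvd hw hz
  refine ⟨(M : ℤ) * w, ?_⟩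
  set B : ℕ := Nat.lcmUpto (22 * n) * Nat.lcmUpto (26 * n) with hB
  have hB0 : (B : ℚ) ≠ 0 := by
    exact_mod_cast Nat.mul_ne_zero (Nat.lcmUpto_pos _).ne' (Nat.lcmUpto_pos _).ne'
  have hT0 : ((topProd n : ℕ) : ℚ) ≠ 0 := by exact_mod_cast topProd_ne_zero n
  have hM' : ((fudge n : ℕ) : ℚ) * (lcmNormaliser n : ℕ) * (topProd n : ℕ) = (B : ℚ) * M := by
    exact_mod_cast hM
  have hw'' : (z : ℚ) = ((topProd n : ℕ) : ℚ) * (w : ℚ) := by exact_mod_cast hw'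
  have hP : formPT (aT n) (bT n) = (z : ℚ) / B := by
    rw [eq_div_iff hB0, mul_comm]; exact hz
  rw [Nat.cast_mul, hP, hw'']
  push_cast
  field_simp
  linear_combination (w : ℚ) * hM'

/-- **The ♭ coincidence from PRINT + the top window** (PROVED implication; inputs NOT certified):
`DecayT c' → 31 − ivlRate 9 < c' → Prop3T → TopWindowT → ∀ᶠ n, p_n = −p̂_n`. -/
theorem pCoincidence_eventually_of_topWindowT {c' : ℝ} (hDT : DecayT c')
    (hc' : 31 - ivlRate 9 < c') (h3 : Prop3T) (hW : TopWindowT) :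
    ∀ᶠ n : ℕ in atTop, formP (aP15 n) (bP15 n) = -formPT (aT n) (bT n) :=
  pCoincidence_eventually_flat hDT hc' (integralTFlat_of_prop3T_topWindowT h3 hW)

/-- **P15 measure from `DecayT 28.462`, Prop. 3 (print) and the top window** (PROVED
implication; `DecayT`, `TopWindowT` OPEN, `Prop3T` printed-not-formalised):
`μ(ζ(2)) ≤ 5.0499 ∧ μ(ζ(2)) ≤ 5.09541179`.  NOT a claim about `ζ(2)`. -/
theorem zetaTwo_exponent_le_of_topWindowT (hDT : DecayT 28.462) (h3 : Prop3T)
    (hW : TopWindowT) : ExponentLE (zetaValue 2) 5.0499 ∧ zetaTwo_irrationalityExponent_le :=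
  zetaTwo_exponent_le_of_decayT_flat_num hDT (integralTFlat_of_prop3T_topWindowT h3 hW)

end Summit.KontsevichZagierPeriods.Zeta5Search.Denom.TwoTaleP15TopWindow

end
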